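import Mathlib
import HarnessLib
import Summits.Ventures.LatticeQCDFlow.Exactness.NCMCGeneralSpaceReplicaTStatisticStudent

/-!
# ROW 4'S FIXED-COUNT EVENTS REDUCE TO THE STUDENT-RATIO EVENT: ONE ARM WITH `a` BINS ↦ `a − 1`
# SQUARES; TWO ARMS WITH `a` BINS EACH ↦ `2a − 2` SQUARES (EXACT IDENTITIES OF GAUSSIAN MEASURES)

HONEST FRAMING: exact (Metropolis-corrected) sampling algorithms for lattice gauge theory;
figures of merit are autocorrelation/cost numbers at stated couplings and volumes; no
continuum-physics claim.

Venture `LatticeQCDFlow` (cell pub-lqcd), topic `Scoring`; FANOUT row 4 (`s0-u1-b`, GEN-33).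
NEW WORK of the cell (classical; not in Mathlib), no definition, nothing cited as a fact (Helmert's
transformation / the pooled two-sample `t` are NAMED ONLY).

WHY (row 4).  GEN-32's fixed-batch-count / fixed-replica-count coverage theorems print their limits
as `F_a(t) = N(0,1)^{⊗a}{g | a ḡ² ≤ t² s²(g)}` (one run) and
`F⁽²⁾_a(t) = (N(0,1)^{⊗a})^{⊗2}{(g,h) | a(ḡ − h̄)² ≤ t²(s²(g) + s²(h))}` (row 4's A-vs-B criterion
with `a` bins per arm); row 13's replica-`t` files print `L_R(q)` and identify it with the
Student-ratio probability `N(0,1)^{⊗R}{|z₀| ≤ q √((Σ_{r≠0} z_r²)/(R−1))}`.  This file proves the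
EXACT identities joining the three (no limit, no null set discarded): `F_a = L_a` (§2) and
`F⁽²⁾_a = L_{2a−1}` (§3) — the two-arm criterion with `a` bins per arm is calibrated exactly like
a one-arm bar with `2a − 1` bins.  Hence everything known for `L_R` transfers verbatim to row 4's
functionals: the value `(2/π) arctan` at `R = 2`, under-coverage `≤ N(0,1)([−t,t])`, the limit
`N(0,1)([−t,t])`, and the strict increase in `R` (`Scoring/GaussianStudentCountMonotone`).
Proof: Helmert's reflection `O` (row 13's `helmertReflection_coord`,
`sum_sq_erase_helmertReflection_eq_sumSqDev`, imported) read on `ι → ℝ` preserves `N(0,1)^{⊗ι}`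
(§1: `map_pi_eq_stdGaussian`, `stdGaussian_map`); it carries `a ḡ²` to `z₀²` and `(a−1)s²` to
`Σ_{r≠0} z_r²`.  For two arms, after `O ⊗ O`, on ONE product Gaussian over `Fin a ⊕ Fin a` the pair
`((z_{inl 0} − z_{inr 0})/√2, remaining 2a−2 coordinates)` has law `N(0,1) ⊗ N(0,1)^{⊗(2a−2)}`
(independent Gaussian difference, `iIndepFun.indepFun_finset`, `measurePreserving_sumPiEquivProdPi`).

## Content

* `measurePreserving_helmert_pi` (§1) — `z ↦ ofLp (O (toLp z))` preserves `N(0,1)^{⊗ι}`.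
* `setOf_studentRatio_erase_eq` (§2) — split form `{|z₀| ≤ q√((Σ_j z_{j+1}²)/n)}` = row 13's
  `univ.erase` / `Fintype.card` form; `abs_le_mul_sqrt_iff_sq_le`.
* **`pi_gaussianReal_student_eq_studentRatio`** (§2) — `t ≥ 0`, `a = n + 1`:
  `N(0,1)^{⊗a}{a ḡ² ≤ t² s²(g)} = N(0,1)^{⊗a}{|z₀| ≤ t √((Σ_{j=1}^{n} z_j²)/n)}`.
* `pi_gaussianReal_studentRatio_eq_prod` (§3) — the split event through `piFinSuccAbove 0`;
  `pi_sum_gaussianReal_map_diffHead_tails` — the joint law `N(0,1) ⊗ N(0,1)^{⊗(n+n)}`.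
* **`pi_gaussianReal_twoSample_student_eq_studentRatio`** (§3) — `t ≥ 0`, `a = n + 1 ≥ 2`:
  `(N(0,1)^{⊗a} ⊗ N(0,1)^{⊗a}){a(ḡ − h̄)² ≤ t²(s²(g) + s²(h))} = N(0,1)^{⊗(2n+1)}{|z₀| ≤ t √((Σ_{j=1}^{2n} z_j²)/(2n))}`.

Depends on row 13's BUILT `Exactness/NCMCGeneralSpaceReplicaTStatisticStudent` (Helmert lemmas)
and Mathlib.  [ours] throughout.
-/

open MeasureTheory ProbabilityTheory Filter Topology Finset

namespace Summit.Ventures.LatticeQCDFlow.Scoring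

open Set WithLp
open scoped RealInnerProductSpace

/-! ## §1 Helmert's reflection, read on `ι → ℝ`, preserves the product Gaussian -/

section Helmert

variable {ι : Type*} [Fintype ι] [DecidableEq ι]

/-- **The coordinate form `z ↦ ofLp (O (toLp z))` of Helmert's reflection `O` (row 13's
`helmertReflection_*`) preserves `N(0,1)^{⊗ι}`**: `toLp` carries the product Gaussian to the
standard Gaussian of `EuclideanSpace ℝ ι` (`map_pi_eq_stdGaussian`), which every linear isometry
preserves (`stdGaussian_map`). [ours] -/
theorem measurePreserving_helmert_pi [Nonempty ι] (r₀ : ι) :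
    MeasurePreserving (fun z : ι → ℝ => ofLp
        (((ℝ ∙ ((toLp 2 (fun _ : ι => (Real.sqrt (Fintype.card ι))⁻¹) : EuclideanSpace ℝ ι)
          - EuclideanSpace.single r₀ (1 : ℝ)))ᗮ).reflection (toLp 2 z)))
      (Measure.pi fun _ : ι => gaussianReal 0 1) (Measure.pi fun _ : ι => gaussianReal 0 1) := by
  set O := ((ℝ ∙ ((toLp 2 (fun _ : ι => (Real.sqrt (Fintype.card ι))⁻¹) : EuclideanSpace ℝ ι)
        - EuclideanSpace.single r₀ (1 : ℝ)))ᗮ).reflection with hO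
  have hmeas_toLp : Measurable (toLp 2 : (ι → ℝ) → EuclideanSpace ℝ ι) := by fun_prop
  have hmeas_ofLp : Measurable (ofLp : EuclideanSpace ℝ ι → (ι → ℝ)) := by fun_prop
  have hO_meas : Measurable (O : EuclideanSpace ℝ ι → EuclideanSpace ℝ ι) := O.continuous.measurable
  refine ⟨hmeas_ofLp.comp (hO_meas.comp hmeas_toLp), ?_⟩
  have hcomp : (fun z : ι → ℝ => ofLp (O (toLp 2 z)))
      = (ofLp : EuclideanSpace ℝ ι → (ι → ℝ)) ∘ O ∘ (toLp 2) := rfl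
  rw [hcomp, ← Measure.map_map hmeas_ofLp (hO_meas.comp hmeas_toLp),
    ← Measure.map_map hO_meas hmeas_toLp, map_pi_eq_stdGaussian, stdGaussian_map O,
    ← map_pi_eq_stdGaussian, Measure.map_map hmeas_ofLp hmeas_toLp]
  have hid : (ofLp : EuclideanSpace ℝ ι → (ι → ℝ)) ∘ (toLp 2) = id := funext fun z => rfl
  rw [hid, Measure.map_id]

end Helmert

/-! ## §2 One sample: row 4's fixed-count event `{a ḡ² ≤ t² s²(g)}` has the Student-ratio
## probability -/

section OneSample

/-- `|x| ≤ t √D ↔ x² ≤ t² D` for `t ≥ 0`, `D ≥ 0`. [ours] -/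
theorem abs_le_mul_sqrt_iff_sq_le {x t D : ℝ} (ht : 0 ≤ t) (hD : 0 ≤ D) :
    |x| ≤ t * Real.sqrt D ↔ x ^ 2 ≤ t ^ 2 * D := by
  have htD : 0 ≤ t * Real.sqrt D := mul_nonneg ht (Real.sqrt_nonneg D)
  constructor
  · intro h
    have h' := sq_le_sq' (abs_le.1 h).1 (abs_le.1 h).2
    rwa [mul_pow, Real.sq_sqrt hD] at h'
  · intro h
    have h' : x ^ 2 ≤ (t * Real.sqrt D) ^ 2 := by rwa [mul_pow, Real.sq_sqrt hD]
    exact abs_le_of_sq_le_sq' h' htD |>.elim fun h1 h2 => abs_le.2 ⟨h1, h2⟩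

/-- **Helmert's identities in the split form** (`a = n + 1` coordinates, `r₀ = 0`): the head of
`O g` is `(Σ g)/√a` and the tail carries the sum of squared deviations,
`Σ_{j=1}^{n} (O g)_j² = Σ_j (g_j − ḡ)²` (row 13's `helmertReflection_coord`,
`sum_sq_erase_helmertReflection_eq_sumSqDev`, re-indexed). [ours] -/
theorem helmert_head_tail (n : ℕ) :
    (∀ g : Fin (n + 1) → ℝ, (ofLp (((ℝ ∙ ((toLp 2 (fun _ : Fin (n + 1) =>
        (Real.sqrt (Fintype.card (Fin (n + 1))))⁻¹) : EuclideanSpace ℝ (Fin (n + 1)))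
          - EuclideanSpace.single 0 (1 : ℝ)))ᗮ).reflection (toLp 2 g))) 0
        = (∑ i, g i) / Real.sqrt ((n + 1 : ℕ) : ℝ)) ∧
    (∀ g : Fin (n + 1) → ℝ, ∑ j : Fin n, (ofLp (((ℝ ∙ ((toLp 2 (fun _ : Fin (n + 1) =>
        (Real.sqrt (Fintype.card (Fin (n + 1))))⁻¹) : EuclideanSpace ℝ (Fin (n + 1)))
          - EuclideanSpace.single 0 (1 : ℝ)))ᗮ).reflection (toLp 2 g))) j.succ ^ 2
        = ∑ j, (g j - (∑ i, g i) / ((n + 1 : ℕ) : ℝ)) ^ 2) := by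
  set O := ((ℝ ∙ ((toLp 2 (fun _ : Fin (n + 1) => (Real.sqrt (Fintype.card (Fin (n + 1))))⁻¹)
      : EuclideanSpace ℝ (Fin (n + 1))) - EuclideanSpace.single 0 (1 : ℝ)))ᗮ).reflection with hO
  have hcard : (Fintype.card (Fin (n + 1)) : ℝ) = ((n + 1 : ℕ) : ℝ) := by rw [Fintype.card_fin]
  refine ⟨fun g => ?_, fun g => ?_⟩
  · have := Exactness.GeneralNCMC.helmertReflection_coord (ι := Fin (n + 1)) 0 (toLp 2 g)
    rw [← hO, hcard] at this
    simpa using this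
  · have hrest : ∑ r ∈ univ.erase 0, (ofLp (O (toLp 2 g))) r ^ 2
        = ∑ j, (g j - (∑ i, g i) / ((n + 1 : ℕ) : ℝ)) ^ 2 := by
      have := Exactness.GeneralNCMC.sum_sq_erase_helmertReflection_eq_sumSqDev
        (ι := Fin (n + 1)) 0 (toLp 2 g)
      rw [← hO, hcard] at this
      simpa using this
    rw [Finset.sum_erase_eq_sub (Finset.mem_univ _), Fin.sum_univ_succ] at hrest
    linarith

/-- **Row 4's one-sample fixed-count event has EXACTLY the Student-ratio probability**: for
`t ≥ 0` and `a = n + 1 ≥ 1` batches,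
`N(0,1)^{⊗a}{g | a ḡ² ≤ t² s²(g)} = N(0,1)^{⊗a}{z | |z₀| ≤ t √((Σ_{j=1}^{n} z_j²)/n)}`
(Helmert: `(O g)₀² = a ḡ²`, `Σ_{r≠0} (O g)_r² = Σ (g_r − ḡ)² = (a−1) s²(g)`; no null set is
discarded).  The left event is VERBATIM the limit event of GEN-32's
`BatchMeansFixedBatchCount` / `ReplicaMeansFixedCount` / `GaussianStudentLimit`. [ours] -/
theorem pi_gaussianReal_student_eq_studentRatio {t : ℝ} (ht : 0 ≤ t) (n : ℕ) :
    (Measure.pi fun _ : Fin (n + 1) => gaussianReal 0 1)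
        {g : Fin (n + 1) → ℝ | ((n + 1 : ℕ) : ℝ) * ((∑ i, g i) / ((n + 1 : ℕ) : ℝ)) ^ 2
          ≤ t ^ 2 * ((∑ j, (g j - (∑ i, g i) / ((n + 1 : ℕ) : ℝ)) ^ 2) / (((n + 1 : ℕ) : ℝ) - 1))}
      = (Measure.pi fun _ : Fin (n + 1) => gaussianReal 0 1)
        {z : Fin (n + 1) → ℝ | |z 0| ≤ t * Real.sqrt ((∑ j : Fin n, z j.succ ^ 2) / (n : ℝ))} := by
  set O := ((ℝ ∙ ((toLp 2 (fun _ : Fin (n + 1) => (Real.sqrt (Fintype.card (Fin (n + 1))))⁻¹)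
      : EuclideanSpace ℝ (Fin (n + 1))) - EuclideanSpace.single 0 (1 : ℝ)))ᗮ).reflection with hO
  set Ψ : (Fin (n + 1) → ℝ) → (Fin (n + 1) → ℝ) := fun z => ofLp (O (toLp 2 z)) with hΨ
  have hmp : MeasurePreserving Ψ (Measure.pi fun _ : Fin (n + 1) => gaussianReal 0 1)
      (Measure.pi fun _ : Fin (n + 1) => gaussianReal 0 1) := by
    have := measurePreserving_helmert_pi (ι := Fin (n + 1)) 0
    rwa [← hO] at this
  have ha : (0 : ℝ) < ((n + 1 : ℕ) : ℝ) := by positivity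
  have ha1 : ((n + 1 : ℕ) : ℝ) - 1 = (n : ℝ) := by push_cast; ring
  obtain ⟨hhead, htail⟩ := helmert_head_tail n
  rw [← hO] at hhead htail
  have hBm : MeasurableSet {z : Fin (n + 1) → ℝ | |z 0| ≤ t * Real.sqrt ((∑ j : Fin n, z j.succ ^ 2)
      / (n : ℝ))} := measurableSet_le (by fun_prop) (by fun_prop)
  -- the source event is the preimage of the target event under the Helmert map
  have hpre : {g : Fin (n + 1) → ℝ | ((n + 1 : ℕ) : ℝ) * ((∑ i, g i) / ((n + 1 : ℕ) : ℝ)) ^ 2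
          ≤ t ^ 2 * ((∑ j, (g j - (∑ i, g i) / ((n + 1 : ℕ) : ℝ)) ^ 2) / (((n + 1 : ℕ) : ℝ) - 1))}
      = Ψ ⁻¹' {z : Fin (n + 1) → ℝ | |z 0| ≤ t * Real.sqrt ((∑ j : Fin n, z j.succ ^ 2) / (n : ℝ))} := by
    ext g
    simp only [Set.mem_setOf_eq, Set.mem_preimage]
    rw [show Ψ g 0 = _ from hhead g, show ∑ j : Fin n, Ψ g j.succ ^ 2 = _ from htail g, ha1]
    set S := ∑ i, g i
    have hD : 0 ≤ (∑ j, (g j - S / ((n + 1 : ℕ) : ℝ)) ^ 2) / (n : ℝ) :=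
      div_nonneg (Finset.sum_nonneg fun j _ => sq_nonneg _) (Nat.cast_nonneg n)
    rw [abs_le_mul_sqrt_iff_sq_le ht hD]
    have : (S / Real.sqrt ((n + 1 : ℕ) : ℝ)) ^ 2 = ((n + 1 : ℕ) : ℝ) * (S / ((n + 1 : ℕ) : ℝ)) ^ 2 := by
      rw [div_pow, Real.sq_sqrt ha.le]
      field_simp
    rw [this]
  rw [hpre, ← Measure.map_apply hmp.measurable hBm, hmp.map_eq]

end OneSample


/-! ## §3 Two samples (row 4's A-vs-B criterion with `a` bins per arm): the event
## `{a(ḡ − h̄)² ≤ t²(s²(g) + s²(h))}` has the Student-ratio probability with `2a − 2` squares -/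

section TwoSample

/-- The split Student-ratio event on `Fin (m + 1) → ℝ` read through the splitting equivalence:
`N(0,1)^{⊗(m+1)}{|z₀| ≤ q √((Σ_j z_{j+1}²)/m)} = (N(0,1) ⊗ N(0,1)^{⊗m}){(u, w) | |u| ≤ q √((Σ_j w_j²)/m)}`.
[ours] -/
theorem pi_gaussianReal_studentRatio_eq_prod (q : ℝ) (m : ℕ) :
    (Measure.pi fun _ : Fin (m + 1) => gaussianReal 0 1)
        {z : Fin (m + 1) → ℝ | |z 0| ≤ q * Real.sqrt ((∑ j : Fin m, z j.succ ^ 2) / (m : ℝ))}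
      = ((gaussianReal 0 1).prod (Measure.pi fun _ : Fin m => gaussianReal 0 1))
        {p : ℝ × (Fin m → ℝ) | |p.1| ≤ q * Real.sqrt ((∑ j, p.2 j ^ 2) / (m : ℝ))} := by
  have hmp := measurePreserving_piFinSuccAbove (fun _ : Fin (m + 1) => gaussianReal 0 1) 0
  have hBm : MeasurableSet {p : ℝ × (Fin m → ℝ) | |p.1| ≤ q * Real.sqrt ((∑ j, p.2 j ^ 2) / (m : ℝ))} :=
    measurableSet_le (by fun_prop) (by fun_prop)
  have hA : {z : Fin (m + 1) → ℝ | |z 0| ≤ q * Real.sqrt ((∑ j : Fin m, z j.succ ^ 2) / (m : ℝ))}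
      = MeasurableEquiv.piFinSuccAbove (fun _ : Fin (m + 1) => ℝ) 0 ⁻¹'
        {p : ℝ × (Fin m → ℝ) | |p.1| ≤ q * Real.sqrt ((∑ j, p.2 j ^ 2) / (m : ℝ))} := by
    ext z
    simp only [Set.mem_setOf_eq, Set.mem_preimage, MeasurableEquiv.piFinSuccAbove_apply,
      Fin.insertNthEquiv, Equiv.coe_fn_symm_mk, Fin.removeNth_zero, Fin.tail]
  rw [hA, ← Measure.map_apply (MeasurableEquiv.measurable _) hBm, hmp.map_eq]

/-- **The joint law behind the two-arm reduction.**  On ONE product Gaussian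
`N(0,1)^{⊗(Fin (n+1) ⊕ Fin (n+1))}` (arm A = `inl`, arm B = `inr`), the pair
`(U, V) = ((x_{inl 0} − x_{inr 0})/√2, (x_{inl (j+1)})_j ++ (x_{inr (j+1)})_j)` has law
`N(0,1) ⊗ N(0,1)^{⊗(n+n)}`: `U` is EXACTLY standard normal, `V` collects the `2n` other coordinates,
and the two are independent (disjoint coordinate sets). [ours] -/
theorem pi_sum_gaussianReal_map_diffHead_tails (n : ℕ) :
    (Measure.pi fun _ : Fin (n + 1) ⊕ Fin (n + 1) => gaussianReal 0 1).map
        (fun x : Fin (n + 1) ⊕ Fin (n + 1) → ℝ =>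
          ((x (Sum.inl 0) - x (Sum.inr 0)) / Real.sqrt 2,
            fun k : Fin (n + n) => x (Sum.map Fin.succ Fin.succ (finSumFinEquiv.symm k))))
      = (gaussianReal 0 1).prod (Measure.pi fun _ : Fin (n + n) => gaussianReal 0 1) := by
  set π' := Measure.pi fun _ : Fin (n + 1) ⊕ Fin (n + 1) => gaussianReal 0 1 with hπ'
  set ιe : Fin (n + n) → Fin (n + 1) ⊕ Fin (n + 1) :=
    fun k => Sum.map Fin.succ Fin.succ (finSumFinEquiv.symm k) with hιe
  -- all coordinates are independent standard normals
  have hI : iIndepFun (fun (i : Fin (n + 1) ⊕ Fin (n + 1)) (x : Fin (n + 1) ⊕ Fin (n + 1) → ℝ) => x i) π' :=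
    iIndepFun_pi (X := fun _ x => x) fun _ => aemeasurable_id
  have hev : ∀ i : Fin (n + 1) ⊕ Fin (n + 1),
      HasLaw (fun x : Fin (n + 1) ⊕ Fin (n + 1) → ℝ => x i) (gaussianReal 0 1) π' := fun i =>
    (measurePreserving_eval (fun _ : Fin (n + 1) ⊕ Fin (n + 1) => gaussianReal 0 1) i).hasLaw
  -- the numerator `U`
  have hU : HasLaw (fun x : Fin (n + 1) ⊕ Fin (n + 1) → ℝ => (x (Sum.inl 0) - x (Sum.inr 0)) / Real.sqrt 2)
      (gaussianReal 0 1) π' := by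
    have hind : IndepFun (fun x : Fin (n + 1) ⊕ Fin (n + 1) → ℝ => x (Sum.inl 0))
        (fun x => x (Sum.inr 0)) π' := hI.indepFun (by simp)
    have hneg := gaussianReal_neg (hev (Sum.inr 0))
    have hind' : IndepFun (fun x : Fin (n + 1) ⊕ Fin (n + 1) → ℝ => x (Sum.inl 0))
        (-(fun x : Fin (n + 1) ⊕ Fin (n + 1) → ℝ => x (Sum.inr 0))) π' :=
      hind.comp measurable_id measurable_neg
    have hsum := gaussianReal_add_gaussianReal_of_indepFun hind' (hev (Sum.inl 0)).map_eq hneg.map_eq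
    rw [neg_zero, add_zero] at hsum
    have hD : HasLaw (fun x : Fin (n + 1) ⊕ Fin (n + 1) → ℝ => x (Sum.inl 0) - x (Sum.inr 0))
        (gaussianReal 0 (1 + 1)) π' := by
      refine ⟨((measurable_pi_apply (Sum.inl 0)).sub (measurable_pi_apply (Sum.inr 0))).aemeasurable, ?_⟩
      rw [← hsum]
      rfl
    have h := gaussianReal_div_const hD (Real.sqrt 2)
    rw [zero_div] at h
    convert h using 2
    apply NNReal.eq
    rw [NNReal.coe_div, NNReal.coe_add, NNReal.coe_mk, Real.sq_sqrt (by norm_num : (0 : ℝ) ≤ 2),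
      NNReal.coe_one]
    norm_num
  -- the other coordinates `V`
  have hιe_inj : Function.Injective ιe := by
    intro k k' h
    have := (Sum.map_injective.2 ⟨Fin.succ_injective _, Fin.succ_injective _⟩) h
    exact finSumFinEquiv.symm.injective this
  have hV : HasLaw (fun (x : Fin (n + 1) ⊕ Fin (n + 1) → ℝ) (k : Fin (n + n)) => x (ιe k))
      (Measure.pi fun _ : Fin (n + n) => gaussianReal 0 1) π' := by
    have hind : iIndepFun (fun (k : Fin (n + n)) (x : Fin (n + 1) ⊕ Fin (n + 1) → ℝ) => x (ιe k)) π' :=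
      hI.precomp hιe_inj
    have hmeas : ∀ k : Fin (n + n),
        AEMeasurable (fun x : Fin (n + 1) ⊕ Fin (n + 1) → ℝ => x (ιe k)) π' := fun k =>
      (measurable_pi_apply _).aemeasurable
    refine ⟨(measurable_pi_lambda _ fun k => measurable_pi_apply _).aemeasurable, ?_⟩
    rw [(iIndepFun_iff_map_fun_eq_pi_map hmeas).1 hind]
    congr 1
    funext k
    exact (hev (ιe k)).map_eq
  -- independence of `U` and `V`: disjoint coordinate sets
  have hUV : IndepFun (fun x : Fin (n + 1) ⊕ Fin (n + 1) → ℝ => (x (Sum.inl 0) - x (Sum.inr 0)) / Real.sqrt 2)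
      (fun (x : Fin (n + 1) ⊕ Fin (n + 1) → ℝ) (k : Fin (n + n)) => x (ιe k)) π' := by
    classical
    set S : Finset (Fin (n + 1) ⊕ Fin (n + 1)) := {Sum.inl 0, Sum.inr 0} with hS
    set T : Finset (Fin (n + 1) ⊕ Fin (n + 1)) := Finset.univ.image ιe with hT
    have hST : Disjoint S T := by
      rw [Finset.disjoint_left]
      intro i hi hiT
      rcases Finset.mem_image.1 hiT with ⟨k, -, rfl⟩
      simp only [hS, Finset.mem_insert, Finset.mem_singleton] at hi
      rcases h : finSumFinEquiv.symm k with j | j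
      · simp [hιe, h] at hi
      · simp [hιe, h] at hi
    have hfin := hI.indepFun_finset S T hST fun i => measurable_pi_apply i
    have h0S : Sum.inl 0 ∈ S := by simp [hS]
    have h1S : Sum.inr 0 ∈ S := by simp [hS]
    have hkT : ∀ k, ιe k ∈ T := fun k => Finset.mem_image_of_mem _ (Finset.mem_univ k)
    have hgU : Measurable fun y : S → ℝ => (y ⟨Sum.inl 0, h0S⟩ - y ⟨Sum.inr 0, h1S⟩) / Real.sqrt 2 :=
      ((measurable_pi_apply (⟨Sum.inl 0, h0S⟩ : S)).sub
        (measurable_pi_apply (⟨Sum.inr 0, h1S⟩ : S))).div_const _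
    have hgV : Measurable fun (y : T → ℝ) (k : Fin (n + n)) => y ⟨ιe k, hkT k⟩ :=
      measurable_pi_lambda _ fun k => measurable_pi_apply _
    exact hfin.comp hgU hgV
  -- assemble
  rw [(indepFun_iff_map_prod_eq_prod_map_map hU.aemeasurable hV.aemeasurable).1 hUV, hU.map_eq,
    hV.map_eq]


/-- **Row 4's two-arm fixed-count event has EXACTLY the Student-ratio probability with `2a − 2`
squares** (`a = n + 1 ≥ 2` bins per arm, `t ≥ 0`):
`(N(0,1)^{⊗a} ⊗ N(0,1)^{⊗a}){(g, h) | a(ḡ − h̄)² ≤ t²(s²(g) + s²(h))}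
   = N(0,1)^{⊗(2n+1)}{z | |z₀| ≤ t √((Σ_{j=1}^{2n} z_j²)/(2n))}`,
i.e. the two-arm criterion with `a` bins per arm is calibrated EXACTLY like a one-arm bar with
`2a − 1` bins (`P(|t_{2a−2}| ≤ t)` in textbook notation).  The left event is VERBATIM the limit event
of GEN-32's `BatchMeansTwoChainFixedBatchCount` / `ReplicaTwoArmFixedCount` /
`GaussianTwoSampleStudentLimit`.  Proof: Helmert on each arm (§1), then on ONE product Gaussian over
`Fin a ⊕ Fin a` the pair `((y₀ − y₀')/√2, other coordinates)` has law `N(0,1) ⊗ N(0,1)^{⊗2n}`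
(`pi_sum_gaussianReal_map_diffHead_tails`). [ours] -/
theorem pi_gaussianReal_twoSample_student_eq_studentRatio {t : ℝ} (ht : 0 ≤ t) {n : ℕ} (hn : 1 ≤ n) :
    ((Measure.pi fun _ : Fin (n + 1) => gaussianReal 0 1).prod
        (Measure.pi fun _ : Fin (n + 1) => gaussianReal 0 1))
      {p : (Fin (n + 1) → ℝ) × (Fin (n + 1) → ℝ) |
        ((n + 1 : ℕ) : ℝ) * ((∑ i, p.1 i) / ((n + 1 : ℕ) : ℝ) - (∑ i, p.2 i) / ((n + 1 : ℕ) : ℝ)) ^ 2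
          ≤ t ^ 2 * (((∑ j, (p.1 j - (∑ i, p.1 i) / ((n + 1 : ℕ) : ℝ)) ^ 2) / (((n + 1 : ℕ) : ℝ) - 1))
            + ((∑ j, (p.2 j - (∑ i, p.2 i) / ((n + 1 : ℕ) : ℝ)) ^ 2) / (((n + 1 : ℕ) : ℝ) - 1)))}
      = (Measure.pi fun _ : Fin (n + n + 1) => gaussianReal 0 1)
        {z : Fin (n + n + 1) → ℝ | |z 0| ≤ t *
          Real.sqrt ((∑ j : Fin (n + n), z j.succ ^ 2) / ((n + n : ℕ) : ℝ))} := by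
  set γ : Measure ℝ := gaussianReal 0 1 with hγ
  set π := Measure.pi fun _ : Fin (n + 1) => γ with hπ
  set O := ((ℝ ∙ ((toLp 2 (fun _ : Fin (n + 1) => (Real.sqrt (Fintype.card (Fin (n + 1))))⁻¹)
      : EuclideanSpace ℝ (Fin (n + 1))) - EuclideanSpace.single 0 (1 : ℝ)))ᗮ).reflection with hO
  set Ψ : (Fin (n + 1) → ℝ) → (Fin (n + 1) → ℝ) := fun z => ofLp (O (toLp 2 z)) with hΨ
  have hΨmp : MeasurePreserving Ψ π π := by
    have := measurePreserving_helmert_pi (ι := Fin (n + 1)) 0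
    rwa [← hO] at this
  have hn0 : (0 : ℝ) < n := by exact_mod_cast hn
  have ha : (0 : ℝ) < ((n + 1 : ℕ) : ℝ) := by positivity
  have ha1 : ((n + 1 : ℕ) : ℝ) - 1 = (n : ℝ) := by push_cast; ring
  have hnn : ((n + n : ℕ) : ℝ) = 2 * (n : ℝ) := by push_cast; ring
  -- Helmert identities for one arm, in the split form
  obtain ⟨hhead, htail⟩ := helmert_head_tail n
  rw [← hO] at hhead htail
  -- Step 1: the event is the preimage under `Ψ × Ψ` of the "difference of heads / tails" event
  set E' : Set ((Fin (n + 1) → ℝ) × (Fin (n + 1) → ℝ)) := {p |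
    |(p.1 0 - p.2 0) / Real.sqrt 2| ≤ t * Real.sqrt ((∑ j : Fin n, p.1 j.succ ^ 2
      + ∑ j : Fin n, p.2 j.succ ^ 2) / ((n + n : ℕ) : ℝ))} with hE'
  have hE'm : MeasurableSet E' := measurableSet_le (by fun_prop) (by fun_prop)
  have hpre : {p : (Fin (n + 1) → ℝ) × (Fin (n + 1) → ℝ) |
        ((n + 1 : ℕ) : ℝ) * ((∑ i, p.1 i) / ((n + 1 : ℕ) : ℝ) - (∑ i, p.2 i) / ((n + 1 : ℕ) : ℝ)) ^ 2
          ≤ t ^ 2 * (((∑ j, (p.1 j - (∑ i, p.1 i) / ((n + 1 : ℕ) : ℝ)) ^ 2) / (((n + 1 : ℕ) : ℝ) - 1))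
            + ((∑ j, (p.2 j - (∑ i, p.2 i) / ((n + 1 : ℕ) : ℝ)) ^ 2) / (((n + 1 : ℕ) : ℝ) - 1)))}
      = (Prod.map Ψ Ψ) ⁻¹' E' := by
    ext p
    simp only [Set.mem_setOf_eq, Set.mem_preimage, hE', Prod.map_fst, Prod.map_snd]
    rw [show Ψ p.1 0 = _ from hhead p.1, show Ψ p.2 0 = _ from hhead p.2,
      show ∑ j : Fin n, Ψ p.1 j.succ ^ 2 = _ from htail p.1,
      show ∑ j : Fin n, Ψ p.2 j.succ ^ 2 = _ from htail p.2, ha1]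
    set Sg := ∑ i, p.1 i
    set Sh := ∑ i, p.2 i
    set Rg := ∑ j, (p.1 j - Sg / ((n + 1 : ℕ) : ℝ)) ^ 2
    set Rh := ∑ j, (p.2 j - Sh / ((n + 1 : ℕ) : ℝ)) ^ 2
    have hD : 0 ≤ (Rg + Rh) / ((n + n : ℕ) : ℝ) := div_nonneg (add_nonneg
      (Finset.sum_nonneg fun j _ => sq_nonneg _) (Finset.sum_nonneg fun j _ => sq_nonneg _))
      (Nat.cast_nonneg _)
    rw [abs_le_mul_sqrt_iff_sq_le ht hD, hnn]
    have hsa : Real.sqrt ((n + 1 : ℕ) : ℝ) ≠ 0 := (Real.sqrt_pos.2 ha).ne'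
    have hs2 : Real.sqrt 2 ≠ 0 := (Real.sqrt_pos.2 (by norm_num : (0:ℝ) < 2)).ne'
    have key1 : ((Sg / Real.sqrt ((n + 1 : ℕ) : ℝ) - Sh / Real.sqrt ((n + 1 : ℕ) : ℝ)) / Real.sqrt 2) ^ 2
        = (1 / 2) * (((n + 1 : ℕ) : ℝ) * (Sg / ((n + 1 : ℕ) : ℝ) - Sh / ((n + 1 : ℕ) : ℝ)) ^ 2) := by
      rw [div_pow, Real.sq_sqrt (by norm_num : (0:ℝ) ≤ 2), ← sub_div, div_pow,
        Real.sq_sqrt ha.le]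
      field_simp
    have key2 : t ^ 2 * ((Rg + Rh) / (2 * (n : ℝ))) = (1 / 2) * (t ^ 2 * (Rg / (n : ℝ) + Rh / (n : ℝ))) := by
      field_simp
    rw [key1, key2]
    constructor <;> intro h <;> linarith
  rw [hpre, ← Measure.map_apply (hΨmp.measurable.prodMap hΨmp.measurable) hE'm,
    (hΨmp.prod hΨmp).map_eq]
  -- Step 2: move to ONE product Gaussian over `Fin (n+1) ⊕ Fin (n+1)`
  set π' := Measure.pi fun _ : Fin (n + 1) ⊕ Fin (n + 1) => γ with hπ'
  have hσ : MeasurePreserving (MeasurableEquiv.sumPiEquivProdPi fun _ : Fin (n + 1) ⊕ Fin (n + 1) => ℝ)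
      π' (π.prod π) := measurePreserving_sumPiEquivProdPi fun _ : Fin (n + 1) ⊕ Fin (n + 1) => γ
  rw [← hσ.map_eq, Measure.map_apply (MeasurableEquiv.measurable _) hE'm]
  -- Step 3: the pulled-back event is `(U, V) ⁻¹' B`
  set ιe : Fin (n + n) → Fin (n + 1) ⊕ Fin (n + 1) :=
    fun k => Sum.map Fin.succ Fin.succ (finSumFinEquiv.symm k) with hιe
  set UV : (Fin (n + 1) ⊕ Fin (n + 1) → ℝ) → ℝ × (Fin (n + n) → ℝ) := fun x =>
    ((x (Sum.inl 0) - x (Sum.inr 0)) / Real.sqrt 2, fun k => x (ιe k)) with hUV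
  set B : Set (ℝ × (Fin (n + n) → ℝ)) :=
    {p | |p.1| ≤ t * Real.sqrt ((∑ k, p.2 k ^ 2) / ((n + n : ℕ) : ℝ))} with hB
  have hBm : MeasurableSet B := measurableSet_le (by fun_prop) (by fun_prop)
  have hUVm : Measurable UV := by fun_prop
  have hsumV : ∀ x : Fin (n + 1) ⊕ Fin (n + 1) → ℝ, ∑ k, x (ιe k) ^ 2
      = ∑ j : Fin n, x (Sum.inl j.succ) ^ 2 + ∑ j : Fin n, x (Sum.inr j.succ) ^ 2 := by
    intro x
    rw [hιe, Equiv.sum_comp finSumFinEquiv.symm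
      (fun s : Fin n ⊕ Fin n => x (Sum.map Fin.succ Fin.succ s) ^ 2), Fintype.sum_sum_type]
    simp
  have hpre2 : (MeasurableEquiv.sumPiEquivProdPi fun _ : Fin (n + 1) ⊕ Fin (n + 1) => ℝ) ⁻¹' E'
      = UV ⁻¹' B := by
    ext x
    simp only [hE', hB, hUV, Set.mem_preimage, Set.mem_setOf_eq,
      MeasurableEquiv.coe_sumPiEquivProdPi, Equiv.sumPiEquivProdPi, Equiv.coe_fn_mk, hsumV]
  rw [hpre2, ← Measure.map_apply hUVm hBm, hUV, hιe, pi_sum_gaussianReal_map_diffHead_tails n,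
    pi_gaussianReal_studentRatio_eq_prod t (n + n)]

end TwoSample

end Summit.Ventures.LatticeQCDFlow.Scoring
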